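import Literature.Algebra.Lie.LefschetzModuleAdjoint
import Literature.Algebra.Lie.LefschetzModuleDirectSum
import Mathlib.LinearAlgebra.Dual.Lemmas
import HarnessLib

/-!
# `𝔤(𝔞' × 𝔞'', M' ⊠ M'') = 𝔤(𝔞', M') × 𝔤(𝔞'', M'')`: Lefschetz modules are closed under tensor products (Looijenga–Lunts 1997, §1)

Topic `Literature/Algebra/Lie` (namespace `Literature.Algebra.Lie`).  Lane `lit-hodgefound` (Track 2 foundations
library), skeleton seat `lit-hodgefound-skel-1` (generation 41), row **A1-104** of
`run/shared/lean/pub/lit-hodgefound/SKELETON.md`: the TENSOR-PRODUCT clause of "closed under direct sums, tensor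
products and taking duals", with its Lie-algebra statement — the companion of `LefschetzModuleDirectSum.lean` (A1-99,
the direct-sum clause) and of `LefschetzModule.lean` §8 (A1-90: the Lefschetz PROPERTY of `e ⊗ 1 + 1 ⊗ e'`), made
possible by `LefschetzModuleAdjoint.lean` §1 (A1-101: "if `h` and `e` happen to be contained in a semisimple Lie
subalgebra `𝔤 ⊂ 𝔤𝔩(M)`, then so is `f`").  PROVED theorems and two definitions with bodies (`tensorSubmodule` =
`𝔞 ⊠ 𝔟`, `tensorLieHom` = `(x, y) ↦ x ⊗ 1 + 1 ⊗ y`); no named fact, no `sorry`, no instance (D-0026 net debt `0`).  The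
commutator Lie ring of `𝔤𝔩(·)` is Mathlib's reducible non-instance `LieRing.ofAssociativeRing`, enabled FILE-LOCALLY as
in the rest of the series.

## Source, VERBATIM

E. Looijenga, V. A. Lunts, *A Lie algebra attached to a projective variety*, Invent. Math. **129** (1997) 361–412 (held
text `paper:arxiv-alg-geom_9604014`, p0004):

> (L62–L63) "The collection of Lefschetz modules is closed under direct sums, tensor products and taking duals."
> (L72–L88) "There is also an exterior direct sum and tensor product: if `(𝔞', M')` and `(𝔞'', M'')` are Lefschetz
> modules, then we have defined Lefschetz modules `(𝔞' × 𝔞'', M' ⊞ M'')`, `e_{(a',a'')}(m', m'') = (e_{a'} m', e_{a''} m'')`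
> [and] `(𝔞' × 𝔞'', M' ⊠ M'')`, `e_{(a',a'')}(m' ⊗ m'') = e_{a'} m' ⊗ m'' + m' ⊗ e_{a''} m''`. The associated Lie
> algebra is in the first case equal to `𝔤(𝔞', M') × 𝔤(𝔞'', M'')`. This is also true in the second case if both
> factors are nonzero."
> (L25–L26) "If `h` and `e` happen to be contained in a semisimple Lie subalgebra `𝔤 ⊂ 𝔤𝔩(M)`, then so is `f`."

No proof is printed.

## Rendering (dictionary, continuing A1-88 / A1-90 / A1-99)

* `(M ⊗ N, h ⊗ 1 + 1 ⊗ h')` = `TensorProduct K M N` with `h.rTensor N + h'.lTensor M` (A1-90); "`M' ⊠ M''`".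
* "`𝔞' × 𝔞''` acting by `e_{a'} m' ⊗ m'' + m' ⊗ e_{a''} m''`" = **`tensorSubmodule K 𝔞 𝔟`** `= {a ⊗ 1 + 1 ⊗ b} ≤ 𝔤𝔩(M ⊗ N)`
  (the image of `𝔞 × 𝔟`; as in A1-88, a Lefschetz module is rendered on the image of `e`).
* "`𝔤(𝔞', M') × 𝔤(𝔞'', M'')`" inside `𝔤𝔩(M' ⊠ M'')` = the range of **`tensorLieHom K 𝔤 𝔤'`** `: 𝔤 × 𝔤' → 𝔤𝔩(M ⊗ N)`,
  `(x, y) ↦ x ⊗ 1 + 1 ⊗ y` (Mathlib's product Lie algebra); "equal to `𝔤' × 𝔤''`" = the range equals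
  `𝔤(𝔞 ⊠ 𝔟, M ⊗ N)` AND the map is injective (`tensorLieHom_injective`, "if both factors are nonzero").

## Contents (all proved)

* §1 `tensorSubmodule` (`mem_tensorSubmodule_iff`, `rTensor_add_lTensor_mem_tensorSubmodule`), `tensorLieHom`
  (`tensorLieHom_apply`, `mem_range_tensorLieHom_iff`, `rTensor_add_lTensor_mem_range_tensorLieHom`,
  `tensorSubmodule_le_range`).
* §2 `tmul_ne_zero_of_ne_zero`, `exists_eq_smul_id_of_rTensor_eq_lTensor` (`x ⊗ 1 = 1 ⊗ y` ⟹ `x` a homothety),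
  `eq_zero_of_lTensor_eq_zero`; **`isSl2Triple_rTensor_add_lTensor`** (`𝔰𝔩₂`-triples are closed under `⊠`);
  `rTensor_add_lTensor_ne_zero` (the total degree operator is non-zero).
* §3 **`rTensor_mem_lefschetzLieAlgebra_tensor`** / `lTensor_mem_lefschetzLieAlgebra_tensor` (`𝔤(𝔞, M) ⊗ 1` and
  `1 ⊗ 𝔤(𝔟, N)` lie in `𝔤(𝔞 ⊠ 𝔟, M ⊗ N)` — `lieSpan_induction`, the partner `f_a ⊗ 1` being recovered from
  `[h ⊗ 1, f_a ⊗ 1 + 1 ⊗ f_{b₀}] = -2 f_a ⊗ 1`), `range_tensorLieHom_le`.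
* §4 `isSemisimple_range_tensorLieHom`; **`lefschetzLieAlgebra_tensor_le`** (the reverse inclusion: EVERY partner of a
  Lefschetz element of `𝔞 ⊠ 𝔟` lies in the semisimple image — A1-101's `mem_of_isSl2Triple`);
  **`IsLefschetzModule.lefschetzLieAlgebra_tensor_eq`** (`𝔤(𝔞 ⊠ 𝔟, M ⊗ N) =` the image of `𝔤(𝔞, M) × 𝔤(𝔟, N)`);
  **`tensorLieHom_injective`** ("if both factors are nonzero"); `IsLefschetzModule.isSemisimple_lefschetzLieAlgebra_tensor`;
  **`IsLefschetzModule.tensor`** (the tensor product of Lefschetz modules is a Lefschetz module).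

## Proof (none is printed)

`⊇`: as for direct sums (A1-99) — generators `e_a ⊗ 1 = e_{(a,0)}`, and `f_a ⊗ 1 = -½[h ⊗ 1, F]` with
`F = f_a ⊗ 1 + 1 ⊗ f_{b₀}` the partner of `e_a ⊗ 1 + 1 ⊗ e_{b₀}` for a Lefschetz `b₀ ∈ 𝔟` and `h ⊗ 1 = [e_a ⊗ 1, F]`.
`⊆`: the generators `e_a ⊗ 1 + 1 ⊗ e_b` lie in the image `𝔊` of `𝔤(𝔞, M) × 𝔤(𝔟, N)`, a SEMISIMPLE Lie subalgebra of
`𝔤𝔩(M ⊗ N)` (surjective image of a product of semisimple algebras) containing `h ⊗ 1 + 1 ⊗ h'`; by "so is `f`"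
(A1-101, Morozov's lemma + Bourbaki I §6 Prop. 1) every partner of every Lefschetz element of `𝔞 ⊠ 𝔟` lies in `𝔊` — in
particular one never needs to know WHICH `e_a ⊗ 1 + 1 ⊗ e_b` are Lefschetz.  Injectivity: `x ⊗ 1 + 1 ⊗ y = 0` makes `x`
a homothety `c·1` (slice with a functional), traceless because `𝔤(𝔞, M) ⊂ 𝔰𝔩(M)` (Bourbaki I §6 Cor. of Thm. 1), so
`c · dim M = 0`, `c = 0`, `x = 0`, `y = 0`.

## SCOPE (what is NOT formalised here)

(a) The clause "taking duals" at the level of `IsLefschetzModule` (A1-94 has the Lefschetz property of `-eᵀ`) and the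
internal tensor product of two Lefschetz `𝔞`-modules (same `𝔞`, diagonal action) are not in this file.  (b) (1.2) Lemma
(irreducible Lefschetz modules of `𝔤' × 𝔤''` are `M' ⊗ M''`) is not formalised.  (c) Nothing here concerns complex tori
or the Hodge conjecture.

## References

* [LooijengaLunts1997] E. Looijenga, V. A. Lunts, *A Lie algebra attached to a projective variety*, Invent. Math. 129
  (1997) 361–412; arXiv:alg-geom/9604014. §1 p. 4 L25–L26, L62–L63, L72–L88 (held `paper:arxiv-alg-geom_9604014`
  p0004).
* [Bourbaki1989LieGroups13] N. Bourbaki, *Lie Groups and Lie Algebras, Chapters 1–3*, Ch. I §6 no. 1 Cor. of Thm. 1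
  (`ρ(𝔤) ⊂ 𝔰𝔩(V)`), Remark 3 (products) (held p0105) — via the tree's `trace_toEnd_eq_zero_of_hasTrivialRadical`,
  `isSemisimple_prod`.
-/

noncomputable section

namespace Literature.Algebra.Lie

open Module Function Set LieModule
open scoped TensorProduct

-- The commutator Lie ring of `𝔤𝔩(·) = Module.End K ·`: Mathlib's reducible NON-instance `LieRing.ofAssociativeRing`,
-- enabled file-locally exactly as in `LefschetzModule.lean` / `LefschetzModuleDirectSum.lean`.
attribute [local instance 100] LieRing.ofAssociativeRing

/-! ### §1 `𝔞 ⊠ 𝔟` and the map `(x, y) ↦ x ⊗ 1 + 1 ⊗ y` -/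

section Defs

variable (K : Type*) [CommRing K] {M N : Type*} [AddCommGroup M] [Module K M] [AddCommGroup N] [Module K N]

/-- **`𝔞 ⊠ 𝔟 := {e_a ⊗ 1 + 1 ⊗ e_b | a ∈ 𝔞, b ∈ 𝔟} ≤ 𝔤𝔩(M ⊗ N)`**, the image of `𝔞' × 𝔞''` acting on `M' ⊠ M''` by
"`e_{(a',a'')}(m' ⊗ m'') = e_{a'} m' ⊗ m'' + m' ⊗ e_{a''} m''`" (`LinearMap.rTensor` / `LinearMap.lTensor`).
[cite: LooijengaLunts1997, §1 (1.1) p0004 L72–L82] -/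
def tensorSubmodule (𝔞 : Submodule K (Module.End K M)) (𝔟 : Submodule K (Module.End K N)) :
    Submodule K (Module.End K (M ⊗[K] N)) where
  carrier := {x | ∃ a ∈ 𝔞, ∃ b ∈ 𝔟, x = a.rTensor N + b.lTensor M}
  add_mem' := by
    rintro _ _ ⟨a, ha, b, hb, rfl⟩ ⟨a', ha', b', hb', rfl⟩
    refine ⟨a + a', 𝔞.add_mem ha ha', b + b', 𝔟.add_mem hb hb', ?_⟩
    rw [LinearMap.rTensor_add, LinearMap.lTensor_add]; abel
  zero_mem' := ⟨0, 𝔞.zero_mem, 0, 𝔟.zero_mem, by rw [LinearMap.rTensor_zero, LinearMap.lTensor_zero, add_zero]⟩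
  smul_mem' := by
    rintro c _ ⟨a, ha, b, hb, rfl⟩
    exact ⟨c • a, 𝔞.smul_mem c ha, c • b, 𝔟.smul_mem c hb, by
      rw [LinearMap.rTensor_smul, LinearMap.lTensor_smul, smul_add]⟩

variable {K}

/-- Membership in `𝔞 ⊠ 𝔟`. [cite: LooijengaLunts1997, §1 (1.1) p0004 L72–L82] -/
theorem mem_tensorSubmodule_iff {𝔞 : Submodule K (Module.End K M)} {𝔟 : Submodule K (Module.End K N)}
    {x : Module.End K (M ⊗[K] N)} :
    x ∈ tensorSubmodule K 𝔞 𝔟 ↔ ∃ a ∈ 𝔞, ∃ b ∈ 𝔟, x = a.rTensor N + b.lTensor M := Iff.rfl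

/-- `e_a ⊗ 1 + 1 ⊗ e_b ∈ 𝔞 ⊠ 𝔟`. [cite: LooijengaLunts1997, §1 (1.1) p0004 L72–L82] -/
theorem rTensor_add_lTensor_mem_tensorSubmodule {𝔞 : Submodule K (Module.End K M)} {𝔟 : Submodule K (Module.End K N)}
    {a : Module.End K M} {b : Module.End K N} (ha : a ∈ 𝔞) (hb : b ∈ 𝔟) :
    a.rTensor N + b.lTensor M ∈ tensorSubmodule K 𝔞 𝔟 :=
  ⟨a, ha, b, hb, rfl⟩

variable (K) in
/-- **The morphism `𝔤 × 𝔤' → 𝔤𝔩(M ⊗ N)`, `(x, y) ↦ x ⊗ 1 + 1 ⊗ y`**, of two Lie subalgebras `𝔤 ≤ 𝔤𝔩(M)`, `𝔤' ≤ 𝔤𝔩(N)`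
— a morphism of Lie algebras by A1-90's `lie_rTensor_add_lTensor` (`[x ⊗ 1 + 1 ⊗ y, x' ⊗ 1 + 1 ⊗ y'] =
[x, x'] ⊗ 1 + 1 ⊗ [y, y']`); its range is "`𝔤(𝔞', M') × 𝔤(𝔞'', M'')`" inside `𝔤𝔩(M' ⊠ M'')`.
[cite: LooijengaLunts1997, §1 (1.1) p0004 L86–L88 ("This is also true in the second case if both factors are nonzero")] -/
def tensorLieHom (G : LieSubalgebra K (Module.End K M)) (G' : LieSubalgebra K (Module.End K N)) :
    G × G' →ₗ⁅K⁆ Module.End K (M ⊗[K] N) where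
  toFun x := (x.1 : Module.End K M).rTensor N + (x.2 : Module.End K N).lTensor M
  map_add' x y := by
    show ((x.1 : Module.End K M) + y.1).rTensor N + ((x.2 : Module.End K N) + y.2).lTensor M = _
    rw [LinearMap.rTensor_add, LinearMap.lTensor_add]; abel
  map_smul' c x := by
    show (c • (x.1 : Module.End K M)).rTensor N + (c • (x.2 : Module.End K N)).lTensor M = _
    rw [LinearMap.rTensor_smul, LinearMap.lTensor_smul, RingHom.id_apply, smul_add]
  map_lie' {x y} := by
    show ((⁅x.1, y.1⁆ : G) : Module.End K M).rTensor N + ((⁅x.2, y.2⁆ : G') : Module.End K N).lTensor M = _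
    rw [LieSubalgebra.coe_bracket, LieSubalgebra.coe_bracket, ← lie_rTensor_add_lTensor]

/-- `tensorLieHom (x, y) = x ⊗ 1 + 1 ⊗ y`. [cite: LooijengaLunts1997, §1 (1.1) p0004 L86–L88] -/
theorem tensorLieHom_apply (G : LieSubalgebra K (Module.End K M)) (G' : LieSubalgebra K (Module.End K N)) (x : G × G') :
    tensorLieHom K G G' x = (x.1 : Module.End K M).rTensor N + (x.2 : Module.End K N).lTensor M := rfl

/-- The range of `tensorLieHom` is `{x ⊗ 1 + 1 ⊗ y | x ∈ 𝔤, y ∈ 𝔤'}`. [cite: LooijengaLunts1997, §1 (1.1) p0004 L86–L88] -/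
theorem mem_range_tensorLieHom_iff {G : LieSubalgebra K (Module.End K M)} {G' : LieSubalgebra K (Module.End K N)}
    {z : Module.End K (M ⊗[K] N)} :
    z ∈ (tensorLieHom K G G').range ↔ ∃ x ∈ G, ∃ y ∈ G', z = x.rTensor N + y.lTensor M := by
  rw [LieHom.mem_range]
  constructor
  · rintro ⟨⟨x, y⟩, rfl⟩
    exact ⟨x, x.2, y, y.2, rfl⟩
  · rintro ⟨x, hx, y, hy, rfl⟩
    exact ⟨(⟨x, hx⟩, ⟨y, hy⟩), rfl⟩

/-- `x ⊗ 1 + 1 ⊗ y` lies in the range for `x ∈ 𝔤`, `y ∈ 𝔤'`. [cite: LooijengaLunts1997, §1 (1.1) p0004 L86–L88] -/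
theorem rTensor_add_lTensor_mem_range_tensorLieHom {G : LieSubalgebra K (Module.End K M)}
    {G' : LieSubalgebra K (Module.End K N)} {x : Module.End K M} {y : Module.End K N} (hx : x ∈ G) (hy : y ∈ G') :
    x.rTensor N + y.lTensor M ∈ (tensorLieHom K G G').range :=
  mem_range_tensorLieHom_iff.2 ⟨x, hx, y, hy, rfl⟩

/-- `𝔞 ⊠ 𝔟` lies in the range of `tensorLieHom 𝔤 𝔤'` when `𝔞 ⊆ 𝔤`, `𝔟 ⊆ 𝔤'`. [cite: LooijengaLunts1997, §1 (1.1) p0004 L86–L88] -/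
theorem tensorSubmodule_le_range {𝔞 : Submodule K (Module.End K M)} {𝔟 : Submodule K (Module.End K N)}
    {G : LieSubalgebra K (Module.End K M)} {G' : LieSubalgebra K (Module.End K N)} (h𝔞 : 𝔞 ≤ G.toSubmodule)
    (h𝔟 : 𝔟 ≤ G'.toSubmodule) : tensorSubmodule K 𝔞 𝔟 ≤ (tensorLieHom K G G').range.toSubmodule := by
  rintro _ ⟨a, ha, b, hb, rfl⟩
  exact rTensor_add_lTensor_mem_range_tensorLieHom (h𝔞 ha) (h𝔟 hb)

end Defs

/-! ### §2 `𝔰𝔩₂`-triples `(e ⊗ 1 + 1 ⊗ e', h ⊗ 1 + 1 ⊗ h', f ⊗ 1 + 1 ⊗ f')`; pure tensors -/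

section Triples

variable {K : Type*} [Field K] {M N : Type*} [AddCommGroup M] [Module K M] [AddCommGroup N] [Module K N]
  {h e f : Module.End K M} {h' e' f' : Module.End K N}

/-- A pure tensor of non-zero vectors is non-zero (vector spaces; slice with a functional `φ`, `φ n = 1`).
[cite: LooijengaLunts1997, §1 (1.1) p0004 L88 ("if both factors are nonzero")] -/
theorem tmul_ne_zero_of_ne_zero {m : M} {n : N} (hm : m ≠ 0) (hn : n ≠ 0) : m ⊗ₜ[K] n ≠ 0 := by
  obtain ⟨φ, hφ⟩ := Module.Projective.exists_dual_eq_one K hn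
  intro h0
  have h1 := congrArg (fun z ↦ TensorProduct.rid K M (φ.lTensor M z)) h0
  simp only [LinearMap.lTensor_tmul, TensorProduct.rid_tmul, hφ, one_smul, map_zero] at h1
  exact hm h1

/-- `x ⊗ 1 = 1 ⊗ y` forces `x` to be a homothety (`N ≠ 0`). [cite: LooijengaLunts1997, §1 (1.1) p0004 L88 ("if both factors are nonzero")] -/
theorem exists_eq_smul_id_of_rTensor_eq_lTensor {x : Module.End K M} {y : Module.End K N} {n : N} (hn : n ≠ 0)
    (hxy : x.rTensor N = y.lTensor M) : ∃ c : K, x = c • LinearMap.id := by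
  obtain ⟨φ, hφ⟩ := Module.Projective.exists_dual_eq_one K hn
  refine ⟨φ (y n), LinearMap.ext fun m ↦ ?_⟩
  have h1 := congrArg (fun z ↦ TensorProduct.rid K M (φ.lTensor M z)) (LinearMap.congr_fun hxy (m ⊗ₜ[K] n))
  simp only [LinearMap.rTensor_tmul, LinearMap.lTensor_tmul, TensorProduct.rid_tmul, hφ, one_smul] at h1
  rw [h1, LinearMap.smul_apply, LinearMap.id_apply]

/-- `1 ⊗ y = 0` forces `y = 0` (`M ≠ 0`). [cite: LooijengaLunts1997, §1 (1.1) p0004 L88] -/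
theorem eq_zero_of_lTensor_eq_zero [Nontrivial M] {y : Module.End K N} (hy : y.lTensor M = 0) : y = 0 := by
  obtain ⟨m, hm⟩ := exists_ne (0 : M)
  refine LinearMap.ext fun n ↦ ?_
  by_contra hyn
  have h1 := LinearMap.congr_fun hy (m ⊗ₜ[K] n)
  rw [LinearMap.lTensor_tmul, LinearMap.zero_apply] at h1
  exact tmul_ne_zero_of_ne_zero hm hyn h1

/-- **`𝔰𝔩₂`-triples are closed under tensor products**: `(e ⊗ 1 + 1 ⊗ e', h ⊗ 1 + 1 ⊗ h', f ⊗ 1 + 1 ⊗ f')` satisfies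
the `𝔰𝔩₂`-relations (A1-90's `lie_rTensor_add_lTensor`), hence is an `𝔰𝔩₂`-triple of `𝔤𝔩(M ⊗ N)` as soon as
`h ⊗ 1 + 1 ⊗ h' ≠ 0`. [cite: LooijengaLunts1997, §1 (1.1) p0004 L62–L63, L72–L82] -/
theorem isSl2Triple_rTensor_add_lTensor (t : IsSl2Triple h e f) (t' : IsSl2Triple h' e' f')
    (h0 : h.rTensor N + h'.lTensor M ≠ 0) :
    IsSl2Triple (h.rTensor N + h'.lTensor M) (e.rTensor N + e'.lTensor M) (f.rTensor N + f'.lTensor M) where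
  h_ne_zero := h0
  lie_e_f := by rw [lie_rTensor_add_lTensor, t.lie_e_f, t'.lie_e_f]
  lie_h_e_nsmul := by
    rw [lie_rTensor_add_lTensor, t.lie_h_e_nsmul, t'.lie_h_e_nsmul, two_nsmul, two_nsmul, two_nsmul,
      LinearMap.rTensor_add, LinearMap.lTensor_add]
    abel
  lie_h_f_nsmul := by
    rw [lie_rTensor_add_lTensor, t.lie_h_f_nsmul, t'.lie_h_f_nsmul, two_nsmul, two_nsmul, two_nsmul,
      LinearMap.rTensor_neg, LinearMap.lTensor_neg, LinearMap.rTensor_add, LinearMap.lTensor_add]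
    abel

variable [CharZero K]

/-- The total degree operator `h ⊗ 1 + 1 ⊗ h'` is non-zero as soon as `(M, h)` carries an `𝔰𝔩₂`-triple `(a, h, f_a)`
and `N ≠ 0` is `ℤ`-graded: on `x ⊗ n` with `n ∈ N_j` non-zero, `h ⊗ 1 + 1 ⊗ h' = 0` would force `h = -j·1`, whence
`[h, a] = 0 ≠ 2a`. [cite: LooijengaLunts1997, §1 (1.1) p0004 L88 ("if both factors are nonzero")] -/
theorem rTensor_add_lTensor_ne_zero [Nontrivial N] {a fa : Module.End K M} (t : IsSl2Triple h a fa)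
    (hgr' : IsZGrading h') : h.rTensor N + h'.lTensor M ≠ 0 := by
  -- a non-zero homogeneous vector of `N`
  obtain ⟨n₀, hn₀⟩ := exists_ne (0 : N)
  have hex : ∃ j : ℤ, ∃ n ∈ degreeSpace h' j, n ≠ 0 := by
    by_contra hno
    push Not at hno
    apply hn₀
    have hmem : n₀ ∈ ⨆ j : ℤ, degreeSpace h' j := by rw [hgr']; exact Submodule.mem_top
    have : (⨆ j : ℤ, degreeSpace h' j) = ⊥ := iSup_eq_bot.2 fun j ↦ (Submodule.eq_bot_iff _).2 (hno j)
    rw [this, Submodule.mem_bot] at hmem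
    exact hmem
  obtain ⟨j, n, hn, hn0⟩ := hex
  -- `a ≠ 0` of degree `2`: some `m ∈ M_?`... use `a` and `h`: `[h, a] = 2a`, so `a m` and `m` cannot both be killed
  intro H0
  have key : ∀ x : M, (h x) ⊗ₜ[K] n + x ⊗ₜ[K] h' n = 0 := fun x ↦ by
    have := LinearMap.congr_fun H0 (x ⊗ₜ[K] n)
    rwa [rTensor_add_lTensor_tmul, LinearMap.zero_apply] at this
  have hn' : h' n = (j : K) • n := mem_degreeSpace_iff.1 hn
  -- from `key x`: `h x ⊗ n = -(j) x ⊗ n`, i.e. `(h x + j x) ⊗ n = 0`, so `h x = -j x` for all `x`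
  have hx : ∀ x : M, h x = -((j : K) • x) := fun x ↦ by
    have h1 := key x
    rw [hn', TensorProduct.tmul_smul, TensorProduct.smul_tmul', ← TensorProduct.add_tmul] at h1
    by_contra hne
    exact tmul_ne_zero_of_ne_zero (show h x + (j : K) • x ≠ 0 from fun h2 ↦ hne (eq_neg_of_add_eq_zero_left h2)) hn0 h1
  -- then `[h, a] = 0`, contradicting `[h, a] = 2a ≠ 0`
  have hha : ⁅h, a⁆ = 0 := by
    ext x
    rw [Ring.lie_def, LinearMap.sub_apply, Module.End.mul_apply, Module.End.mul_apply, hx, hx, map_neg, map_smul,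
      LinearMap.zero_apply, sub_eq_zero]
  have h2a : (2 : K) • a = 0 := by rw [← t.lie_h_e_smul K, hha]
  exact t.e_ne_zero ((smul_eq_zero.1 h2a).resolve_left two_ne_zero)

end Triples

/-! ### §3 `𝔤(𝔞, M) ⊗ 1 + 1 ⊗ 𝔤(𝔟, N) ≤ 𝔤(𝔞 ⊠ 𝔟, M ⊗ N)` -/

section LowerBound

variable {K : Type*} [Field K] [CharZero K] {M N : Type*} [AddCommGroup M] [Module K M] [AddCommGroup N] [Module K N]
  {h : Module.End K M} {h' : Module.End K N} {𝔞 : Submodule K (Module.End K M)} {𝔟 : Submodule K (Module.End K N)}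

/-- **`𝔤(𝔞, M) ⊗ 1 ≤ 𝔤(𝔞 ⊠ 𝔟, M ⊗ N)` as soon as `𝔟` has a Lefschetz element `b₀`** (with partner `f₀`) and the
total degree operator is non-zero: for the generators, `e_a ⊗ 1 = e_{(a, 0)} ∈ 𝔞 ⊠ 𝔟`, and for a partner `f_a`,
`F = f_a ⊗ 1 + 1 ⊗ f₀` is the partner of `e_a ⊗ 1 + 1 ⊗ e_{b₀} ∈ 𝔞 ⊠ 𝔟`, `[e_a ⊗ 1, F] = h ⊗ 1` and
`[h ⊗ 1, F] = -2 f_a ⊗ 1` (characteristic `0`); then `lieSpan_induction` (`x ↦ x ⊗ 1` is a morphism of Lie algebras).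
[cite: LooijengaLunts1997, §1 (1.1) p0004 L86–L88] -/
theorem rTensor_mem_lefschetzLieAlgebra_tensor {b₀ f₀ : Module.End K N} (hb₀ : b₀ ∈ 𝔟) (t₀ : IsSl2Triple h' b₀ f₀)
    (h0 : h.rTensor N + h'.lTensor M ≠ 0) {x : Module.End K M} (hx : x ∈ lefschetzLieAlgebra K h 𝔞) :
    x.rTensor N ∈ lefschetzLieAlgebra K (h.rTensor N + h'.lTensor M) (tensorSubmodule K 𝔞 𝔟) := by
  set G := lefschetzLieAlgebra K (h.rTensor N + h'.lTensor M) (tensorSubmodule K 𝔞 𝔟) with hG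
  have hgen : ∀ a ∈ 𝔞, a.rTensor N ∈ G := fun a ha ↦ by
    have h1 := mem_lefschetzLieAlgebra_of_mem (K := K) (h := h.rTensor N + h'.lTensor M)
      (rTensor_add_lTensor_mem_tensorSubmodule ha 𝔟.zero_mem)
    rwa [LinearMap.lTensor_zero, add_zero] at h1
  rw [lefschetzLieAlgebra] at hx
  induction hx using LieSubalgebra.lieSpan_induction with
  | mem x hx =>
    rcases hx with hx | ⟨a, ha, t₁⟩
    · exact hgen x hx
    · -- `x = f_a`
      have h2 : x.rTensor N + f₀.lTensor M ∈ G :=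
        mem_lefschetzLieAlgebra_of_isSl2Triple (rTensor_add_lTensor_mem_tensorSubmodule ha hb₀)
          (isSl2Triple_rTensor_add_lTensor t₁ t₀ h0)
      have h3 : h.rTensor N ∈ G := by
        have h4 := G.lie_mem (hgen a ha) h2
        rwa [← add_zero (a.rTensor N), ← LinearMap.lTensor_zero M, lie_rTensor_add_lTensor, t₁.lie_e_f, zero_lie,
          LinearMap.lTensor_zero, add_zero] at h4
      have h5 : ((-2 : K) • x).rTensor N ∈ G := by
        have h6 := G.lie_mem h3 h2
        rwa [← add_zero (h.rTensor N), ← LinearMap.lTensor_zero M, lie_rTensor_add_lTensor, t₁.lie_lie_smul_f K,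
          zero_lie, LinearMap.lTensor_zero, add_zero, ← neg_smul] at h6
      have h7 := G.smul_mem (-2 : K)⁻¹ h5
      rwa [LinearMap.rTensor_smul, smul_smul, inv_mul_cancel₀ (by norm_num : (-2 : K) ≠ 0), one_smul] at h7
  | zero => rw [LinearMap.rTensor_zero]; exact G.zero_mem
  | add x y _ _ hx hy => rw [LinearMap.rTensor_add]; exact G.add_mem hx hy
  | smul c x _ hx => rw [LinearMap.rTensor_smul]; exact G.smul_mem c hx
  | lie x y _ _ hx hy =>
    have h1 := G.lie_mem hx hy
    rwa [← add_zero (x.rTensor N), ← LinearMap.lTensor_zero M, ← add_zero (y.rTensor N), ← LinearMap.lTensor_zero M,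
      lie_rTensor_add_lTensor, lie_zero, LinearMap.lTensor_zero, add_zero] at h1

/-- … and symmetrically **`1 ⊗ 𝔤(𝔟, N) ≤ 𝔤(𝔞 ⊠ 𝔟, M ⊗ N)`** when `𝔞` has a Lefschetz element.
[cite: LooijengaLunts1997, §1 (1.1) p0004 L86–L88] -/
theorem lTensor_mem_lefschetzLieAlgebra_tensor {a₀ f₀ : Module.End K M} (ha₀ : a₀ ∈ 𝔞) (t₀ : IsSl2Triple h a₀ f₀)
    (h0 : h.rTensor N + h'.lTensor M ≠ 0) {y : Module.End K N} (hy : y ∈ lefschetzLieAlgebra K h' 𝔟) :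
    y.lTensor M ∈ lefschetzLieAlgebra K (h.rTensor N + h'.lTensor M) (tensorSubmodule K 𝔞 𝔟) := by
  set G := lefschetzLieAlgebra K (h.rTensor N + h'.lTensor M) (tensorSubmodule K 𝔞 𝔟) with hG
  have hgen : ∀ b ∈ 𝔟, b.lTensor M ∈ G := fun b hb ↦ by
    have h1 := mem_lefschetzLieAlgebra_of_mem (K := K) (h := h.rTensor N + h'.lTensor M)
      (rTensor_add_lTensor_mem_tensorSubmodule 𝔞.zero_mem hb)
    rwa [LinearMap.rTensor_zero, zero_add] at h1
  rw [lefschetzLieAlgebra] at hy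
  induction hy using LieSubalgebra.lieSpan_induction with
  | mem y hy =>
    rcases hy with hy | ⟨b, hb, t₂⟩
    · exact hgen y hy
    · have h2 : f₀.rTensor N + y.lTensor M ∈ G :=
        mem_lefschetzLieAlgebra_of_isSl2Triple (rTensor_add_lTensor_mem_tensorSubmodule ha₀ hb)
          (isSl2Triple_rTensor_add_lTensor t₀ t₂ h0)
      have h3 : h'.lTensor M ∈ G := by
        have h4 := G.lie_mem (hgen b hb) h2
        rwa [← zero_add (b.lTensor M), ← LinearMap.rTensor_zero N, lie_rTensor_add_lTensor, t₂.lie_e_f, zero_lie,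
          LinearMap.rTensor_zero, zero_add] at h4
      have h5 : ((-2 : K) • y).lTensor M ∈ G := by
        have h6 := G.lie_mem h3 h2
        rwa [← zero_add (h'.lTensor M), ← LinearMap.rTensor_zero N, lie_rTensor_add_lTensor, t₂.lie_lie_smul_f K,
          zero_lie, LinearMap.rTensor_zero, zero_add, ← neg_smul] at h6
      have h7 := G.smul_mem (-2 : K)⁻¹ h5
      rwa [LinearMap.lTensor_smul, smul_smul, inv_mul_cancel₀ (by norm_num : (-2 : K) ≠ 0), one_smul] at h7
  | zero => rw [LinearMap.lTensor_zero]; exact G.zero_mem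
  | add x y _ _ hx hy => rw [LinearMap.lTensor_add]; exact G.add_mem hx hy
  | smul c x _ hx => rw [LinearMap.lTensor_smul]; exact G.smul_mem c hx
  | lie x y _ _ hx hy =>
    have h1 := G.lie_mem hx hy
    rwa [← zero_add (x.lTensor M), ← LinearMap.rTensor_zero N, ← zero_add (y.lTensor M), ← LinearMap.rTensor_zero N,
      lie_rTensor_add_lTensor, lie_zero, LinearMap.rTensor_zero, zero_add] at h1

/-- Hence **`(tensorLieHom 𝔤(𝔞, M) 𝔤(𝔟, N)).range ≤ 𝔤(𝔞 ⊠ 𝔟, M ⊗ N)`** when both sides have Lefschetz elements.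
[cite: LooijengaLunts1997, §1 (1.1) p0004 L86–L88] -/
theorem range_tensorLieHom_le {a₀ f₀ : Module.End K M} (ha₀ : a₀ ∈ 𝔞) (t₀ : IsSl2Triple h a₀ f₀)
    {b₀ g₀ : Module.End K N} (hb₀ : b₀ ∈ 𝔟) (t₀' : IsSl2Triple h' b₀ g₀) (h0 : h.rTensor N + h'.lTensor M ≠ 0) :
    (tensorLieHom K (lefschetzLieAlgebra K h 𝔞) (lefschetzLieAlgebra K h' 𝔟)).range ≤
      lefschetzLieAlgebra K (h.rTensor N + h'.lTensor M) (tensorSubmodule K 𝔞 𝔟) := by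
  intro z hz
  obtain ⟨x, hx, y, hy, rfl⟩ := mem_range_tensorLieHom_iff.1 hz
  exact LieSubalgebra.add_mem _ (rTensor_mem_lefschetzLieAlgebra_tensor hb₀ t₀' h0 hx)
    (lTensor_mem_lefschetzLieAlgebra_tensor ha₀ t₀ h0 hy)

end LowerBound

/-! ### §4 `𝔤(𝔞 ⊠ 𝔟, M ⊗ N) = 𝔤(𝔞, M) × 𝔤(𝔟, N)`: the partners stay in the semisimple image; `IsLefschetzModule.tensor` -/

section Main

variable {K : Type*} [Field K] [CharZero K] {M N : Type*} [AddCommGroup M] [Module K M] [FiniteDimensional K M]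
  [AddCommGroup N] [Module K N] [FiniteDimensional K N] {h : Module.End K M} {h' : Module.End K N}
  {𝔞 : Submodule K (Module.End K M)} {𝔟 : Submodule K (Module.End K N)}

/-- The image of `𝔤 × 𝔤'` under `tensorLieHom` is semisimple when `𝔤`, `𝔤'` are (a surjective image of the semisimple
product, A1-99's `isSemisimple_prod` and the tree's `isSemisimple_of_surjective`). [cite: LooijengaLunts1997, §1 (1.1) p0004 L86–L88] -/
theorem isSemisimple_range_tensorLieHom (G : LieSubalgebra K (Module.End K M)) (G' : LieSubalgebra K (Module.End K N))
    [LieAlgebra.IsSemisimple K G] [LieAlgebra.IsSemisimple K G'] :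
    LieAlgebra.IsSemisimple K (tensorLieHom K G G').range := by
  haveI : FiniteDimensional K G := inferInstanceAs (FiniteDimensional K G.toSubmodule)
  haveI : FiniteDimensional K G' := inferInstanceAs (FiniteDimensional K G'.toSubmodule)
  haveI : FiniteDimensional K (tensorLieHom K G G').range :=
    inferInstanceAs (FiniteDimensional K (tensorLieHom K G G').range.toSubmodule)
  haveI := isSemisimple_prod (K := K) (L₁ := G) (L₂ := G')
  exact isSemisimple_of_surjective (tensorLieHom K G G').rangeRestrict (LieHom.surjective_rangeRestrict _)

/-- **`𝔤(𝔞 ⊠ 𝔟, M ⊗ N) ≤ (𝔤(𝔞, M) × 𝔤(𝔟, N))`-image when `𝔤(𝔞, M)`, `𝔤(𝔟, N)` are semisimple**: the generators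
`e_a ⊗ 1 + 1 ⊗ e_b` lie in the image, and so does EVERY partner `F` of a Lefschetz element of `𝔞 ⊠ 𝔟` — by A1-101's
"if `h` and `e` happen to be contained in a semisimple Lie subalgebra `𝔤 ⊂ 𝔤𝔩(M)`, then so is `f`" applied to the
semisimple image inside `𝔤𝔩(M ⊗ N)` (no analysis of which `e_a ⊗ 1 + 1 ⊗ e_b` are Lefschetz is needed).
[cite: LooijengaLunts1997, §1 (1.1) p0004 L25–L26, L86–L88] -/
theorem lefschetzLieAlgebra_tensor_le (hh : h ∈ lefschetzLieAlgebra K h 𝔞) (hh' : h' ∈ lefschetzLieAlgebra K h' 𝔟)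
    [LieAlgebra.IsSemisimple K (lefschetzLieAlgebra K h 𝔞)] [LieAlgebra.IsSemisimple K (lefschetzLieAlgebra K h' 𝔟)] :
    lefschetzLieAlgebra K (h.rTensor N + h'.lTensor M) (tensorSubmodule K 𝔞 𝔟) ≤
      (tensorLieHom K (lefschetzLieAlgebra K h 𝔞) (lefschetzLieAlgebra K h' 𝔟)).range := by
  haveI := isSemisimple_range_tensorLieHom (K := K) (lefschetzLieAlgebra K h 𝔞) (lefschetzLieAlgebra K h' 𝔟)
  rw [lefschetzLieAlgebra_le_iff]
  refine ⟨tensorSubmodule_le_range le_lefschetzLieAlgebra le_lefschetzLieAlgebra, ?_⟩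
  rintro F ⟨E, hE, t⟩
  exact mem_of_isSl2Triple _ (rTensor_add_lTensor_mem_range_tensorLieHom hh hh')
    (tensorSubmodule_le_range le_lefschetzLieAlgebra le_lefschetzLieAlgebra hE) t

/-- **"This is also true in the second case": `𝔤(𝔞 ⊠ 𝔟, M ⊗ N)` is the image of `𝔤(𝔞, M) × 𝔤(𝔟, N)` under
`(x, y) ↦ x ⊗ 1 + 1 ⊗ y`**, for Lefschetz modules `(𝔞, M)`, `(𝔟, N)` with `N ≠ 0`.
[cite: LooijengaLunts1997, §1 (1.1) p0004 L86–L88] -/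
theorem IsLefschetzModule.lefschetzLieAlgebra_tensor_eq [Nontrivial N] (A : IsLefschetzModule K h 𝔞)
    (B : IsLefschetzModule K h' 𝔟) :
    lefschetzLieAlgebra K (h.rTensor N + h'.lTensor M) (tensorSubmodule K 𝔞 𝔟) =
      (tensorLieHom K (lefschetzLieAlgebra K h 𝔞) (lefschetzLieAlgebra K h' 𝔟)).range := by
  haveI := A.isSemisimple
  haveI := B.isSemisimple
  obtain ⟨a₀, ha₀, f₀, t₀⟩ := A.nonempty_lefschetzDomain
  obtain ⟨b₀, hb₀, g₀, t₀'⟩ := B.nonempty_lefschetzDomain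
  exact le_antisymm (lefschetzLieAlgebra_tensor_le A.h_mem B.h_mem)
    (range_tensorLieHom_le ha₀ t₀ hb₀ t₀' (rTensor_add_lTensor_ne_zero t₀ B.isZGrading))

omit [FiniteDimensional K N] in
/-- **"… if both factors are nonzero": `(x, y) ↦ x ⊗ 1 + 1 ⊗ y` is INJECTIVE on `𝔤 × 𝔤'`** for semisimple
`𝔤 ≤ 𝔤𝔩(M)`, `𝔤' ≤ 𝔤𝔩(N)` and `M, N ≠ 0` — so the image is an honest copy of `𝔤(𝔞, M) × 𝔤(𝔟, N)`: if
`x ⊗ 1 + 1 ⊗ y = 0` then `x` is a homothety (`exists_eq_smul_id_of_rTensor_eq_lTensor`), traceless since `𝔤` is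
semisimple (Bourbaki I §6 Cor. of Thm. 1, the tree's `trace_toEnd_eq_zero_of_hasTrivialRadical`), hence `0`
(characteristic `0`), and then `y = 0`. [cite: LooijengaLunts1997, §1 (1.1) p0004 L86–L88] -/
theorem tensorLieHom_injective [Nontrivial M] [Nontrivial N] (G : LieSubalgebra K (Module.End K M))
    (G' : LieSubalgebra K (Module.End K N)) [LieAlgebra.HasTrivialRadical K G] :
    Function.Injective (tensorLieHom K G G') := by
  rw [← LieHom.coe_toLinearMap, ← LinearMap.ker_eq_bot, Submodule.eq_bot_iff]
  rintro ⟨x, y⟩ hxy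
  rw [LinearMap.mem_ker, LieHom.coe_toLinearMap, tensorLieHom_apply, add_eq_zero_iff_eq_neg,
    ← LinearMap.lTensor_neg] at hxy
  obtain ⟨n, hn⟩ := exists_ne (0 : N)
  obtain ⟨c, hc⟩ := exists_eq_smul_id_of_rTensor_eq_lTensor hn hxy
  -- `x = c • id` is traceless, so `c = 0`
  have htr : LinearMap.trace K M (x : Module.End K M) = 0 := by
    have h1 := trace_toEnd_eq_zero_of_hasTrivialRadical (k := K) (L := G) (M := M) x
    rwa [LieSubalgebra.toEnd_eq, LieModule.toEnd_module_end, LieHom.id_apply] at h1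
  rw [hc, map_smul, LinearMap.trace_id, smul_eq_mul, mul_eq_zero] at htr
  have hc0 : c = 0 := htr.resolve_right (Nat.cast_ne_zero.2 Module.finrank_pos.ne')
  have hx0 : (x : Module.End K M) = 0 := by rw [hc, hc0, zero_smul]
  have hy0 : (y : Module.End K N) = 0 := by
    have h1 : (-(y : Module.End K N)).lTensor M = 0 := by rw [← hxy, hx0, LinearMap.rTensor_zero]
    exact neg_eq_zero.1 (eq_zero_of_lTensor_eq_zero h1)
  exact Prod.ext (Subtype.ext hx0) (Subtype.ext hy0)

/-- **`𝔤(𝔞 ⊠ 𝔟, M ⊗ N)` is semisimple for Lefschetz modules `(𝔞, M)`, `(𝔟, N)`** (`N ≠ 0`).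
[cite: LooijengaLunts1997, §1 (1.1) p0004 L62–L63, L86–L88] -/
theorem IsLefschetzModule.isSemisimple_lefschetzLieAlgebra_tensor [Nontrivial N] (A : IsLefschetzModule K h 𝔞)
    (B : IsLefschetzModule K h' 𝔟) :
    LieAlgebra.IsSemisimple K (lefschetzLieAlgebra K (h.rTensor N + h'.lTensor M) (tensorSubmodule K 𝔞 𝔟)) := by
  haveI := A.isSemisimple
  haveI := B.isSemisimple
  rw [A.lefschetzLieAlgebra_tensor_eq B]
  exact isSemisimple_range_tensorLieHom _ _

/-- **"The collection of Lefschetz modules is closed under … tensor products": `(𝔞 ⊠ 𝔟, M ⊗ N)` is a Lefschetz module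
(A1-88's `IsLefschetzModule`) when `(𝔞, M)` and `(𝔟, N)` are** (`N ≠ 0`) — `ℤ`-graded by `h ⊗ 1 + 1 ⊗ h'` (A1-90),
`𝔞 ⊠ 𝔟 ⊆ 𝔤𝔩(M ⊗ N)₂` abelian, with the Lefschetz element `e_a ⊗ 1 + 1 ⊗ e_b` (partner `f_a ⊗ 1 + 1 ⊗ f_b`), and
`𝔤(𝔞 ⊠ 𝔟, M ⊗ N) ≅ 𝔤(𝔞, M) × 𝔤(𝔟, N)` semisimple. [cite: LooijengaLunts1997, §1 (1.1) p0004 L62–L63, L72–L88] -/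
theorem IsLefschetzModule.tensor [Nontrivial N] (A : IsLefschetzModule K h 𝔞) (B : IsLefschetzModule K h' 𝔟) :
    IsLefschetzModule K (h.rTensor N + h'.lTensor M) (tensorSubmodule K 𝔞 𝔟) where
  isZGrading := isZGrading_rTensor_add_lTensor A.isZGrading B.isZGrading
  le_adDegree_two := by
    rintro _ ⟨a, ha, b, hb, rfl⟩
    rw [mem_adDegree_iff, lie_rTensor_add_lTensor, mem_adDegree_iff.1 (A.le_adDegree_two ha),
      mem_adDegree_iff.1 (B.le_adDegree_two hb), LinearMap.rTensor_smul, LinearMap.lTensor_smul, smul_add]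
  lie_eq_zero := by
    rintro _ ⟨a, ha, b, hb, rfl⟩ _ ⟨a', ha', b', hb', rfl⟩
    rw [lie_rTensor_add_lTensor, A.lie_eq_zero a ha a' ha', B.lie_eq_zero b hb b' hb', LinearMap.rTensor_zero,
      LinearMap.lTensor_zero, add_zero]
  nonempty_lefschetzDomain := by
    obtain ⟨a, ha, f₁, t₁⟩ := A.nonempty_lefschetzDomain
    obtain ⟨b, hb, f₂, t₂⟩ := B.nonempty_lefschetzDomain
    exact ⟨a.rTensor N + b.lTensor M, rTensor_add_lTensor_mem_tensorSubmodule ha hb, f₁.rTensor N + f₂.lTensor M,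
      isSl2Triple_rTensor_add_lTensor t₁ t₂ (rTensor_add_lTensor_ne_zero t₁ B.isZGrading)⟩
  isSemisimple := A.isSemisimple_lefschetzLieAlgebra_tensor B

end Main

end Literature.Algebra.Lie
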